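import Literature.MathematicalPhysics.QuantumFieldTheory.ContinuumLimitsYM2Measurability
import Literature.MathematicalPhysics.QuantumFieldTheory.ContinuumLimitsYM2Haar
import Mathlib.MeasureTheory.Integral.Prod
import Mathlib.Analysis.SpecificLimits.Basic
import HarnessLib

/-!
# `YM₂` on the lattice torus, III: heat kernels on a connected compact group equidistribute

Third sibling proof file of
`Literature/MathematicalPhysics/QuantumFieldTheory/ContinuumLimits.lean` towards
`ym2_exists_heatKernel_holds`.  On the torus the lattice Wilson-loop expectation involves the heat
kernel at the *complementary* area, which tends to infinity in the infinite-volume limit; the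
limit is governed by the large-time behaviour proved here:

**Theorem** (`IsGroupHeatKernel.exists_forall_abs_sub_one_le`).  For a heat kernel `p`
(`IsGroupHeatKernel p`) on a compact *connected* group, `p_t → 1` uniformly on `G` as `t → ∞`.

This is the Kawada–Itô equidistribution theorem for the Gaussian semigroup, proved here from the
axioms of `IsGroupHeatKernel` by a Doeblin argument:
1. `p_{s+t}(ab) > 0` whenever `p_s(a), p_t(b) > 0` (the convolution integrand is continuous,
   non-negative and positive at `h = a`; Haar measure charges open sets);
2. hence the open sets `{p_k > 0} ∋ 1` increase with `k ∈ ℕ` and their union is closed, so by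
   connectedness and compactness `p_K > 0` on all of `G` for some `K`, and `p_K ≥ c > 0`;
3. Doeblin's minorisation gives the `L¹` contraction
   `∫|p_{s+K} - 1| ≤ (1 - c) ∫|p_s - 1|` (write `p_{s+K}(g) - 1 = ∫ (p_s(h) - 1)(p_K(h⁻¹g) - c) dh`
   and use Fubini — the integrand is measurable on `G × G` by file I, no second countability);
4. one more convolution converts `L¹` to `sup`: `|p_{s+1}(g) - 1| ≤ (sup p_1) ∫|p_s - 1|`.

Sources: Y. Kawada, K. Itô, *On the probability distribution on a compact group I*, Proc.
Phys.-Math. Soc. Japan 22 (1940) 977–998 (equidistribution of convolution powers); the Doeblin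
coupling is textbook (e.g. Diaconis, *Group representations in probability and statistics*
(1988) Ch. 3).  Everything below is proved from `IsGroupHeatKernel`; no statement of the tree is
changed. [folklore]
-/

noncomputable section

open MeasureTheory Filter Topology Function
open scoped ENNReal
open Literature.MathematicalPhysics.QuantumLattice

namespace Literature.MathematicalPhysics.QuantumFieldTheory.YM2

variable {G : Type*} [Group G] [TopologicalSpace G] [IsTopologicalGroup G] [CompactSpace G]
  [MeasurableSpace G] [BorelSpace G] {p : ℝ → G → ℝ}

/-- Continuous functions on the compact group are Haar integrable. [folklore] -/
theorem integrable_of_continuous {f : G → ℝ} (hf : Continuous f) :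
    Integrable f (haarProbability G) :=
  hf.integrable_of_hasCompactSupport (HasCompactSupport.of_compactSpace _)

omit [Group G] [IsTopologicalGroup G] [MeasurableSpace G] [BorelSpace G] in
/-- Continuous functions on the compact group are bounded. [folklore] -/
theorem exists_forall_abs_le {f : G → ℝ} (hf : Continuous f) : ∃ B : ℝ, 0 < B ∧ ∀ g, |f g| ≤ B := by
  obtain ⟨B, hB⟩ := (isCompact_range hf.abs).bddAbove
  refine ⟨max B 1, by positivity, fun g => (hB ⟨g, rfl⟩).trans (le_max_left _ _)⟩

/-! ### Positivity spreads -/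

/-- `p_s(a) > 0` and `p_t(b) > 0` imply `p_{s+t}(ab) > 0`. [folklore] -/
theorem heatKernel_pos_mul (hp : IsGroupHeatKernel p) {s t : ℝ} (hs : 0 < s) (ht : 0 < t)
    {a b : G} (ha : 0 < p s a) (hb : 0 < p t b) : 0 < p (s + t) (a * b) := by
  haveI := isOpenPosMeasure_haarProbability G
  rw [hp.semigroup s t hs ht]
  have hc : Continuous fun h : G => p s h * p t (h⁻¹ * (a * b)) :=
    (hp.continuous hs).mul ((hp.continuous ht).comp (by fun_prop))
  refine hc.integral_pos_of_hasCompactSupport_nonneg_nonzero (x := a)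
    (HasCompactSupport.of_compactSpace _)
    (fun h => mul_nonneg (hp.nonneg s hs _) (hp.nonneg t ht _)) ?_
  have hab : a⁻¹ * (a * b) = b := by group
  simp only [hab]
  exact (mul_pos ha hb).ne'

/-- On a connected compact group some `p_K`, `K ∈ ℕ`, is everywhere positive, hence bounded below
by a positive constant `c ≤ 1`. [folklore] -/
theorem exists_nat_forall_le_heatKernel [ConnectedSpace G] (hp : IsGroupHeatKernel p) :
    ∃ K : ℕ, 1 ≤ K ∧ ∃ c : ℝ, 0 < c ∧ c ≤ 1 ∧ ∀ g, c ≤ p K g := by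
  have h1pos : ∀ {t : ℝ}, 0 < t → 0 < p t 1 := fun ht =>
    IsGroupHeatKernel.apply_one_pos_holds hp ht
  set P : ℕ → Set G := fun k => {g | 0 < p ((k : ℝ) + 1) g} with hP
  have hPo : ∀ k, IsOpen (P k) := fun k =>
    isOpen_lt continuous_const (hp.continuous (by positivity))
  have hstep : ∀ k (g h : G), g ∈ P k → 0 < p 1 h → g * h ∈ P (k + 1) := by
    intro k g h hg hh
    have h2 := heatKernel_pos_mul hp (by positivity : (0 : ℝ) < k + 1) one_pos hg hh
    simp only [hP, Set.mem_setOf_eq, Nat.cast_succ]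
    exact h2
  have hmono : ∀ k, P k ⊆ P (k + 1) := fun k g hg => by
    simpa using hstep k g 1 hg (h1pos one_pos)
  have hmono' : ∀ k l, k ≤ l → P k ⊆ P l := fun k l hkl => by
    induction hkl with
    | refl => exact subset_rfl
    | step _ ih => exact ih.trans (hmono _)
  set W : Set G := ⋃ k, P k with hW
  have hWo : IsOpen W := isOpen_iUnion hPo
  have hWc : IsClosed W := by
    rw [← closure_subset_iff_isClosed]
    intro g hg
    have hO : IsOpen {w : G | 0 < p 1 (w⁻¹ * g)} :=
      isOpen_lt continuous_const ((hp.continuous one_pos).comp (by fun_prop))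
    have hgO : g ∈ {w : G | 0 < p 1 (w⁻¹ * g)} := by simpa using h1pos one_pos
    obtain ⟨w, hwO, hwW⟩ := mem_closure_iff.1 hg _ hO hgO
    obtain ⟨k, hk⟩ := Set.mem_iUnion.1 hwW
    have h2 := hstep k w (w⁻¹ * g) hk hwO
    rw [mul_inv_cancel_left] at h2
    exact Set.mem_iUnion.2 ⟨k + 1, h2⟩
  have hWuniv : W = Set.univ :=
    IsClopen.eq_univ ⟨hWc, hWo⟩ ⟨1, Set.mem_iUnion.2 ⟨0, h1pos (by positivity)⟩⟩
  obtain ⟨s, hs⟩ := isCompact_univ.elim_finite_subcover P hPo (by rw [← hW, hWuniv])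
  set K₀ : ℕ := s.sup id
  have hK₀ : ∀ g, g ∈ P K₀ := by
    intro g
    have hg := hs (Set.mem_univ g)
    simp only [Set.mem_iUnion, exists_prop] at hg
    obtain ⟨i, hi, hgi⟩ := hg
    exact hmono' i K₀ (Finset.le_sup (f := id) hi) hgi
  -- `p_{K₀+1} > 0` everywhere; take its minimum
  have hcont : Continuous (p ((K₀ : ℝ) + 1)) := hp.continuous (by positivity)
  obtain ⟨g₀, -, hg₀⟩ := isCompact_univ.exists_isMinOn Set.univ_nonempty hcont.continuousOn
  refine ⟨K₀ + 1, Nat.le_add_left 1 K₀, p ((K₀ : ℝ) + 1) g₀, hK₀ g₀, ?_, fun g => ?_⟩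
  · -- `c ≤ 1` since `∫ p = 1` and `p ≥ c`
    have hle : ∫ _g, p ((K₀ : ℝ) + 1) g₀ ∂(haarProbability G) ≤
        ∫ g, p ((K₀ : ℝ) + 1) g ∂(haarProbability G) :=
      integral_mono (integrable_const _) (integrable_of_continuous hcont)
        fun g => hg₀ (Set.mem_univ g)
    rw [integral_const, hp.integral_eq_one _ (by positivity)] at hle
    simpa [probReal_univ] using hle
  · push_cast
    exact hg₀ (Set.mem_univ g)

/-! ### Doeblin's `L¹` contraction -/

/-- The joint integrand of the Doeblin step is measurable on `G × G` for the product σ-algebra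
(word measurability, file I) and integrable. [folklore] -/
theorem integrable_doeblin (hp : IsGroupHeatKernel p) {s K : ℝ} (hs : 0 < s) (hK : 0 < K)
    (u : ℝ → ℝ) (hu : Continuous u) (c : ℝ) :
    Integrable (fun q : G × G => u (p s q.2) * (p K (q.2⁻¹ * q.1) - c))
      ((haarProbability G).prod (haarProbability G)) := by
  have hm1 : Measurable fun q : G × G => u (p s q.2) :=
    hu.measurable.comp ((hp.continuous hs).measurable.comp measurable_snd)
  have hm2 : Measurable fun q : G × G => p K (q.2⁻¹ * q.1) :=
    measurable_comp_mul (measurable_comp_inv (measurable_comp_of_measurable measurable_snd))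
      (measurable_comp_of_measurable measurable_fst) (p K) (hp.continuous hK)
  have hm : Measurable fun q : G × G => u (p s q.2) * (p K (q.2⁻¹ * q.1) - c) :=
    hm1.mul (hm2.sub measurable_const)
  obtain ⟨B₁, -, hB₁⟩ := exists_forall_abs_le (hu.comp (hp.continuous hs))
  obtain ⟨B₂, -, hB₂⟩ := exists_forall_abs_le (hp.continuous hK)
  refine Integrable.of_bound hm.aestronglyMeasurable (B₁ * (B₂ + |c|)) (Eventually.of_forall ?_)
  intro q
  rw [Real.norm_eq_abs, abs_mul]
  refine mul_le_mul (hB₁ q.2) ((abs_sub _ _).trans (by gcongr; exact hB₂ _)) (abs_nonneg _)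
    ((abs_nonneg _).trans (hB₁ q.2))

/-- **Doeblin step.**  If `p_K ≥ c > 0` everywhere then
`∫|p_{s+K} - 1| ≤ (1 - c) ∫|p_s - 1|`. [folklore] -/
theorem integral_abs_sub_one_le_mul (hp : IsGroupHeatKernel p) {s K c : ℝ} (hs : 0 < s)
    (hK : 0 < K) (hc : ∀ g, c ≤ p K g) :
    ∫ g, |p (s + K) g - 1| ∂(haarProbability G) ≤
      (1 - c) * ∫ g, |p s g - 1| ∂(haarProbability G) := by
  haveI := isMulLeftInvariant_haarProbability G
  set μ := haarProbability G
  -- the representation `p_{s+K}(g) - 1 = ∫ (p_s h - 1)(p_K(h⁻¹g) - c) dh`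
  have hrep : ∀ g, p (s + K) g - 1 = ∫ h, (p s h - 1) * (p K (h⁻¹ * g) - c) ∂μ := by
    intro g
    have i1 : Integrable (fun h => p s h * p K (h⁻¹ * g)) μ :=
      integrable_of_continuous ((hp.continuous hs).mul ((hp.continuous hK).comp (by fun_prop)))
    have i2 : Integrable (fun h => p s h) μ := integrable_of_continuous (hp.continuous hs)
    have i3 : Integrable (fun h => p K (h⁻¹ * g)) μ :=
      integrable_of_continuous ((hp.continuous hK).comp (by fun_prop))
    have i2' : Integrable (fun h => c * p s h) μ := i2.const_mul c
    have j1 : Integrable (fun h => p s h * p K (h⁻¹ * g) - c * p s h) μ := i1.sub i2'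
    have j2 : Integrable (fun h => p K (h⁻¹ * g) - c) μ := i3.sub (integrable_const c)
    have hexp : (fun h => (p s h - 1) * (p K (h⁻¹ * g) - c)) =
        fun h => (p s h * p K (h⁻¹ * g) - c * p s h) - (p K (h⁻¹ * g) - c) := by
      funext h; ring
    rw [hexp, integral_sub j1 j2, integral_sub i1 i2', integral_sub i3 (integrable_const c),
      integral_const_mul, ← hp.semigroup s K hs hK g, hp.integral_eq_one s hs,
      integral_heatKernel_inv_mul hp hK g, integral_const, probReal_univ]
    simp
  -- pointwise bound
  have hpt : ∀ g, |p (s + K) g - 1| ≤ ∫ h, |p s h - 1| * (p K (h⁻¹ * g) - c) ∂μ := by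
    intro g
    rw [hrep g]
    refine (abs_integral_le_integral_abs (μ := μ)).trans (le_of_eq ?_)
    refine integral_congr_ae (Eventually.of_forall fun h => ?_)
    simp only [abs_mul, abs_of_nonneg (sub_nonneg.2 (hc (h⁻¹ * g)))]
  -- integrate and swap
  have hF := integrable_doeblin hp hs hK (fun x => |x - 1|) (by fun_prop) c
  calc ∫ g, |p (s + K) g - 1| ∂μ
      ≤ ∫ g, ∫ h, |p s h - 1| * (p K (h⁻¹ * g) - c) ∂μ ∂μ :=
        integral_mono (integrable_of_continuous (by
          have := hp.continuous (add_pos hs hK); fun_prop)) hF.integral_prod_left hpt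
    _ = ∫ h, ∫ g, |p s h - 1| * (p K (h⁻¹ * g) - c) ∂μ ∂μ := integral_integral_swap hF
    _ = ∫ h, |p s h - 1| * (1 - c) ∂μ := by
        refine integral_congr_ae (Eventually.of_forall fun h => ?_)
        have i4 : Integrable (fun g => p K (h⁻¹ * g)) μ :=
          integrable_of_continuous ((hp.continuous hK).comp (by fun_prop))
        simp only
        rw [integral_const_mul, integral_sub i4 (integrable_const c),
          integral_mul_left_eq_self (fun g => p K g) h⁻¹, hp.integral_eq_one K hK,
          integral_const, probReal_univ, smul_eq_mul, one_mul]
    _ = (1 - c) * ∫ g, |p s g - 1| ∂μ := by rw [integral_mul_const, mul_comm]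

/-- Iterated Doeblin step: `∫|p_{s+jK} - 1| ≤ (1-c)^j ∫|p_s - 1|`. [folklore] -/
theorem integral_abs_sub_one_le_pow_mul (hp : IsGroupHeatKernel p) {s K c : ℝ} (hs : 0 < s)
    (hK : 0 < K) (hc : ∀ g, c ≤ p K g) (j : ℕ) :
    ∫ g, |p (s + j * K) g - 1| ∂(haarProbability G) ≤
      (1 - c) ^ j * ∫ g, |p s g - 1| ∂(haarProbability G) := by
  induction j with
  | zero => simp
  | succ j ih =>
    have hc1 : 0 ≤ 1 - c := by
      have := hc 1
      have h1 : c ≤ 1 := by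
        have hle : ∫ _g, c ∂(haarProbability G) ≤ ∫ g, p K g ∂(haarProbability G) :=
          integral_mono (integrable_const _) (integrable_of_continuous (hp.continuous hK)) hc
        rw [integral_const, hp.integral_eq_one _ hK] at hle
        simpa [probReal_univ] using hle
      linarith
    have hsj : 0 < s + j * K := by positivity
    have h := integral_abs_sub_one_le_mul hp hsj hK hc
    have heq : s + ↑(j + 1) * K = s + j * K + K := by push_cast; ring
    rw [heq]
    calc _ ≤ (1 - c) * ∫ g, |p (s + j * K) g - 1| ∂(haarProbability G) := h
      _ ≤ (1 - c) * ((1 - c) ^ j * ∫ g, |p s g - 1| ∂(haarProbability G)) :=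
          mul_le_mul_of_nonneg_left ih hc1
      _ = (1 - c) ^ (j + 1) * ∫ g, |p s g - 1| ∂(haarProbability G) := by ring

/-- `∫|p_s - 1| ≤ 2`. [folklore] -/
theorem integral_abs_sub_one_le_two (hp : IsGroupHeatKernel p) {s : ℝ} (hs : 0 < s) :
    ∫ g, |p s g - 1| ∂(haarProbability G) ≤ 2 := by
  calc ∫ g, |p s g - 1| ∂(haarProbability G) ≤ ∫ g, (p s g + 1) ∂(haarProbability G) := by
        refine integral_mono (integrable_of_continuous (by have := hp.continuous hs; fun_prop))
          ((integrable_of_continuous (hp.continuous hs)).add (integrable_const 1)) fun g => ?_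
        have := hp.nonneg s hs g
        simp only
        rw [abs_le]
        constructor <;> linarith
    _ = 2 := by
        rw [integral_add (integrable_of_continuous (hp.continuous hs)) (integrable_const 1),
          hp.integral_eq_one s hs, integral_const, probReal_univ]
        norm_num

/-- From `L¹` to `sup` by one more convolution: `|p_{s+u}(g) - 1| ≤ (sup p_u) ∫|p_s - 1|`. [folklore] -/
theorem abs_sub_one_le_mul_integral (hp : IsGroupHeatKernel p) {s u B : ℝ} (hs : 0 < s)
    (hu : 0 < u) (hB : ∀ g, p u g ≤ B) (g : G) :
    |p (s + u) g - 1| ≤ B * ∫ h, |p s h - 1| ∂(haarProbability G) := by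
  set μ := haarProbability G
  have i1 : Integrable (fun h => p s h * p u (h⁻¹ * g)) μ :=
    integrable_of_continuous ((hp.continuous hs).mul ((hp.continuous hu).comp (by fun_prop)))
  have i3 : Integrable (fun h => p u (h⁻¹ * g)) μ :=
    integrable_of_continuous ((hp.continuous hu).comp (by fun_prop))
  have hrep : p (s + u) g - 1 = ∫ h, (p s h - 1) * p u (h⁻¹ * g) ∂μ := by
    have hexp : (fun h => (p s h - 1) * p u (h⁻¹ * g)) =
        fun h => p s h * p u (h⁻¹ * g) - p u (h⁻¹ * g) := by
      funext h; ring
    rw [hexp, integral_sub i1 i3, ← hp.semigroup s u hs hu g, integral_heatKernel_inv_mul hp hu g]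
  rw [hrep]
  calc |∫ h, (p s h - 1) * p u (h⁻¹ * g) ∂μ| ≤ ∫ h, |(p s h - 1) * p u (h⁻¹ * g)| ∂μ :=
        abs_integral_le_integral_abs
    _ ≤ ∫ h, B * |p s h - 1| ∂μ := by
        refine integral_mono ?_ ((integrable_of_continuous (by
          have := hp.continuous hs; fun_prop)).const_mul B) fun h => ?_
        · exact (integrable_of_continuous (by
            have := hp.continuous hs; have := hp.continuous hu; fun_prop))
        · simp only
          rw [abs_mul, abs_of_nonneg (hp.nonneg u hu _), mul_comm]
          exact mul_le_mul_of_nonneg_right (hB _) (abs_nonneg _)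
    _ = B * ∫ h, |p s h - 1| ∂μ := integral_const_mul _ _

/-! ### Equidistribution -/

/-- **Equidistribution of the heat kernel on a connected compact group** (Kawada–Itô): for a heat
kernel `p` and `ε > 0` there is `T` with `|p_t(g) - 1| ≤ ε` for all `t ≥ T` and all `g ∈ G`. [folklore] -/
theorem _root_.Literature.MathematicalPhysics.QuantumLattice.IsGroupHeatKernel.exists_forall_abs_sub_one_le
    [ConnectedSpace G] (hp : IsGroupHeatKernel p) {ε : ℝ} (hε : 0 < ε) :
    ∃ T : ℝ, 0 < T ∧ ∀ t, T ≤ t → ∀ g, |p t g - 1| ≤ ε := by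
  obtain ⟨K, hK1, c, hc0, hc1, hc⟩ := exists_nat_forall_le_heatKernel hp
  have hK : (0 : ℝ) < K := by exact_mod_cast hK1
  obtain ⟨B, hB0, hB⟩ := exists_forall_abs_le (hp.continuous one_pos)
  have hB' : ∀ g, p 1 g ≤ B := fun g => (le_abs_self _).trans (hB g)
  -- choose `j` with `B * ((1 - c) ^ j * 2) ≤ ε`
  have hlim : Tendsto (fun j : ℕ => B * ((1 - c) ^ j * 2)) atTop (𝓝 (B * (0 * 2))) :=
    ((tendsto_pow_atTop_nhds_zero_of_lt_one (sub_nonneg.2 hc1) (by linarith)).mul_const 2)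
      |>.const_mul B
  rw [zero_mul, mul_zero] at hlim
  obtain ⟨j, hj⟩ := (hlim.eventually (ge_mem_nhds hε)).exists
  refine ⟨j * K + 2, by positivity, fun t ht g => ?_⟩
  set s : ℝ := t - j * K - 1 with hs_def
  have hs : 0 < s := by rw [hs_def]; linarith
  have ht_eq : t = s + j * K + 1 := by rw [hs_def]; ring
  rw [ht_eq]
  calc |p (s + j * K + 1) g - 1|
      ≤ B * ∫ h, |p (s + j * K) h - 1| ∂(haarProbability G) :=
        abs_sub_one_le_mul_integral hp (by positivity) one_pos hB' g
    _ ≤ B * ((1 - c) ^ j * ∫ h, |p s h - 1| ∂(haarProbability G)) :=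
        mul_le_mul_of_nonneg_left (integral_abs_sub_one_le_pow_mul hp hs hK hc j) hB0.le
    _ ≤ B * ((1 - c) ^ j * 2) :=
        mul_le_mul_of_nonneg_left (mul_le_mul_of_nonneg_left
          (integral_abs_sub_one_le_two hp hs) (pow_nonneg (sub_nonneg.2 hc1) j)) hB0.le
    _ ≤ ε := hj

end Literature.MathematicalPhysics.QuantumFieldTheory.YM2
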